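import Summits.AtomisticToContinuum.BoseEinsteinCondensation.Theorems.BECConjugateDominationPuffFloorSolidCore
import Summits.AtomisticToContinuum.BoseEinsteinCondensation.Theorems.BECConjugateDominationPuffFloorPairMomentOfPairCount
import Summits.AtomisticToContinuum.BoseEinsteinCondensation.Theorems.PuffFloor.Negative.PuffFloorFalseForNearMinimisers
import Mathlib.Analysis.InnerProductSpace.Laplacian

/-!
# Line `coupling-slope-pocket` — skeleton v6 (lead c2, 2026-08-16)
for the crux `BECConjugateDomination.PuffFloor` (stmt-AtomisticToContinuum-11785, route
`route-AtomisticToContinuum-BECConjugateDomination`; lead `prover-line-stmt-AtomisticToContinuum-11785-c2-0`).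

STATE OF THE LINE. The solid-core branch (`0 < v 0`) is LANDED (`Theorems.stub_puffFloorSolidCore`, p93248, over
S1 `stub_pocketClassicalStability` p80034, S2 `stub_noBindingOfStability` p86500, S4a `stub_eulerLagrange` p90323, S4b
`stub_puffFeynmanFloor` p92801/p90930, S5 `stub_positiveMinimiser` p88938, S6 `stub_positiveMinimiserUnique` p89135, S3 Born
inside `…SolidCore`). The coreless branch (`v 0 = 0`) was reduced by lead c1 to the close-pair COUNT at the range scale
(`Theorems.stub_pairMomentOfPairCount`, p98185: count ⇒ Puff pair moment). v6 gives the count a MECHANISM and cuts it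
into six registered stubs plus the lead's composition:

* INNER COUNT by the maximum principle (lead-1's observation, weak form — no mean-value inequality, no square root):
  for the positive `C³` minimiser `Ψ` of `n+2` bosons, every non-negative periodic `C²` test function `f` of
  `x₀ − x₁` satisfies the WEAK PAIR SUBSOLUTION inequality `∫ (Δf + μ₂ f)(x₀−x₁)|Ψ|² ≥ 0`, `μ₂ = E₀(n+2) − E₀(n)`
  (S7a `stub_weakPairSubsolution`: strong Euler–Lagrange × `fΨ`, two integrations by parts on the torus, slice energy
  `≥ E₀(n)`, cross repulsions and `v^per f ≥ 0` dropped); hence the smeared pair density `G_k(y) = E_Ψ[k(x₀−x₁−y)]`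
  (`k` = periodised flat-top bump of radius `δ₀`) is a `C²` subsolution of `Δ + μ₂` on `ℝ³` (S7c
  `stub_smearedPairDensityLaplacian`: differentiation under the integral); on the barrier sphere `|y| = r_*`
  (`r_*` = argmax of the profile, `> 0` for coreless `v ≢ 0`) `k(z − y) ≤ (2/v_max) v^per(z)` pointwise, so
  `G_k ≤ (2/v_max) E_Ψ[v^per(x₀−x₁)]`; the interior MAXIMUM PRINCIPLE (S7d `stub_maxPrinciple`, `μ₂ r_*² ≤ 1`) carries
  the bound inside the ball; a finite `δ₀/2`-net of `B̄(0, r_*/2)` turns it into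
  `E_Ψ #{i<j : |xᵢ−xⱼ|_T ≤ r_*/2} ≤ C_in · periodicEnergy v Ψ` (S7in `stub_innerPairCount`, lead's glue);
* OUTER COUNT by Lee's cell/torus machinery (all in tree) applied to `v' = v + 1_{[0,r_in]}` — which HAS a positive
  core — and `W = 1_{[0,R₀]}`, classical stability being the cube counting `PairCubeCounting.pair_count_le`
  (S7out `stub_pairCountDomination`: count(R₀) ≤ K·(energy + count(r_in)) for EVERY periodic state, `L ≥ L₀`);
* `μ₂ = O(ρ)` by the removal-energy bound (S7b `stub_removalEnergy`: product of an `n`-state with two constants,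
  bosonic = absolute ground-state energy `periodicGroundStateEnergy_le_lintegral_of_periodic`);
* composition (S7′ `corelessPairCount`, a THEOREM here): count(R₀) ≤ K(1 + C_in)·E₀ ≤ K(1+C_in)‖ṽ‖₁ ρ N eventually; then
  c1's landed reduction gives the pair moment (S7, theorem `corelessPairMoment` below), and `PuffFloor_of` case-splits
  (solid core: S8 landed; coreless `v ≢ 0`: this chain; `v ≡ 0` on `[0,∞)`: `W ≡ 0`).

Disproof.lean (cdisprove v7) honoured: exact minimality is used (Euler–Lagrange in S7a; near-minimisers are refuted,
`Negative/PuffFloorFalseForNearMinimisers`); Lee's lever is applied only to the cored comparison potential `v'`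
(`Negative/PocketInstability`: it is void for coreless `v` itself); free gas `v ≡ 0` handled separately (`W ≡ 0`).
-/

noncomputable section

namespace Summit.AtomisticToContinuum.BoseEinsteinCondensation.Cruxes.PuffFloor.CouplingSlopePocket

open MeasureTheory Filter
open scoped ENNReal NNReal BigOperators Laplacian
open Literature.MathematicalPhysics.QuantumManyBody.BoseGas
open Summit.AtomisticToContinuum.BoseEinsteinCondensation.Theses.BECConjugateDomination
open Summit.AtomisticToContinuum.BoseEinsteinCondensation.Theorems.PuffFloorSolidCore

set_option linter.unusedVariables false

/-! ## Negative knowledge imported (no stub is an instance of these refuted variants) -/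

example : ¬ Theorems.PuffFloor.Negative.PuffFloorWithoutMinimality :=
  Theorems.PuffFloor.Negative.puffFloor_false_without_minimality

example : ¬ Theorems.PuffFloor.Negative.PuffFloorNearMinimisers :=
  Theorems.PuffFloor.Negative.puffFloor_false_for_nearMinimisers

/-! ## Landed stubs of the line (aliases of tree theorems; no `sorry`) -/

/-- S4b (Puff–Feynman engine), landed as `Theorems.stub_puffFeynmanFloor` (p92801). -/
theorem stub_puffFeynmanFloor :
    ∃ c₁ c₂ : ℝ, 0 ≤ c₁ ∧ 0 ≤ c₂ ∧
    ∀ v : ℝ → ℝ≥0∞, IsRepulsiveFiniteRange v → (∀ r, v r ≠ ⊤) →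
      ContDiff ℝ 2 (fun x : Space => (v ‖x‖).toReal) →
      ∀ R₀ : ℝ, 0 < R₀ → (∀ r, R₀ < r → v r = 0) →
      ∀ n : ℕ, ∀ L : ℝ, 0 < L → 2 * R₀ < L → ∀ Ψ : PeriodicTrialState (n + 1) L, ContDiff ℝ 3 Ψ.ψ →
        periodicEnergy v Ψ = periodicGroundStateEnergy v (n + 1) L → periodicEnergy v Ψ ≠ ⊤ →
        (∀ X, Ψ.ψ X = (‖Ψ.ψ X‖ : ℂ)) → (∀ X, Ψ.ψ X ≠ 0) →
        (∀ X : Config (n + 1),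
          -(∑ i : Fin (n + 1), ∑ a : Fin 3,
              fderiv ℝ (fun Y : Config (n + 1) =>
                  fderiv ℝ Ψ.ψ Y (Pi.single i (EuclideanSpace.single a (1 : ℝ)))) X
                (Pi.single i (EuclideanSpace.single a (1 : ℝ)))) +
            ((periodicInteraction v L X).toReal : ℂ) * Ψ.ψ X =
          ((periodicGroundStateEnergy v (n + 1) L).toReal : ℂ) * Ψ.ψ X) →
        ∀ Θ : ℝ, 0 ≤ Θ →
          ENNReal.ofReal c₁ * (∫⁻ X in cellN (n + 1) L, kineticDensity Ψ.ψ X) +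
              ENNReal.ofReal c₂ * (∫⁻ X in cellN (n + 1) L,
                periodicInteraction (fun r : ℝ => ENNReal.ofReal (r ^ 2 *
                  ‖iteratedFDeriv ℝ 2 (fun x : Space => (v ‖x‖).toReal)
                    (r • EuclideanSpace.single (0 : Fin 3) (1 : ℝ))‖)) L X *
                  (‖Ψ.ψ X‖₊ : ℝ≥0∞) ^ 2)
            ≤ ENNReal.ofReal (Θ * ((n : ℝ) + 1)) →
          ∀ m : Fin 3 → ℤ, m ≠ 0 →
            ‖(2 * Real.pi / L) • latticeVec 1 m‖ /
                Real.sqrt (‖(2 * Real.pi / L) • latticeVec 1 m‖ ^ 2 + Θ)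
              ≤ ((n : ℝ) + 1)⁻¹ *
                  ∫ X in cellN (n + 1) L, ‖∑ j : Fin (n + 1), cellWave L m (X j)‖ ^ 2 * ‖Ψ.ψ X‖ ^ 2 :=
  Summit.AtomisticToContinuum.BoseEinsteinCondensation.Theorems.stub_puffFeynmanFloor

/-- S8: `PuffFloor` for smooth-class `v` with `0 < v 0` (lets inlined), landed as `Theorems.stub_puffFloorSolidCore`
(p93248). -/
theorem stub_puffFloorSolidCore :
    ∀ v : ℝ → ℝ≥0∞, IsRepulsiveFiniteRange v → (∀ r, v r ≠ ⊤) →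
      ContDiff ℝ 2 (fun x : Space => (v ‖x‖).toReal) →
      (∃ Cₑ : ℝ, ∀ x : Space, ‖iteratedFDeriv ℝ 2 (fun x : Space => (v ‖x‖).toReal) x‖
          ≤ Cₑ * Real.sqrt ((v ‖x‖).toReal)) →
      0 < v 0 →
      ∃ C : ℝ, 0 ≤ C ∧ ∃ ρ₀ : ℝ, 0 < ρ₀ ∧ ∀ ρ : ℝ, 0 < ρ → ρ < ρ₀ → ∀ᶠ n : ℕ in Filter.atTop,
        ∀ Ψ : PeriodicTrialState (n + 1) (sideLength ρ (n + 1)),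
          periodicEnergy v Ψ = periodicGroundStateEnergy v (n + 1) (sideLength ρ (n + 1)) →
          periodicEnergy v Ψ ≠ ⊤ → (∀ X, Ψ.ψ X = (‖Ψ.ψ X‖ : ℂ)) → (∀ X, Ψ.ψ X ≠ 0) →
          ∀ m : Fin 3 → ℤ, m ≠ 0 →
            ‖(2 * Real.pi / sideLength ρ (n + 1)) • latticeVec 1 m‖ /
                Real.sqrt (‖(2 * Real.pi / sideLength ρ (n + 1)) • latticeVec 1 m‖ ^ 2 + C * ρ) ≤
              ((n : ℝ) + 1)⁻¹ *
                ∫ X in cellN (n + 1) (sideLength ρ (n + 1)),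
                  ‖∑ j : Fin (n + 1), cellWave (sideLength ρ (n + 1)) m (X j)‖ ^ 2 * ‖Ψ.ψ X‖ ^ 2 :=
  Summit.AtomisticToContinuum.BoseEinsteinCondensation.Theorems.stub_puffFloorSolidCore

/-- S7r (c1): close-pair COUNT at the range scale ⇒ Puff pair MOMENT, landed as `Theorems.stub_pairMomentOfPairCount`
(p98185). -/
theorem stub_pairMomentOfPairCount :
    ∀ v : ℝ → ℝ≥0∞, IsRepulsiveFiniteRange v → (∀ r, v r ≠ ⊤) →
      ContDiff ℝ 2 (fun x : Space => (v ‖x‖).toReal) →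
      (∃ Cₑ : ℝ, ∀ x : Space, ‖iteratedFDeriv ℝ 2 (fun x : Space => (v ‖x‖).toReal) x‖
          ≤ Cₑ * Real.sqrt ((v ‖x‖).toReal)) →
      ∀ R₀ : ℝ, (∀ r, R₀ < r → v r = 0) →
      (∃ C_N : ℝ, 0 ≤ C_N ∧ ∃ ρ₁ : ℝ, 0 < ρ₁ ∧ ∀ ρ : ℝ, 0 < ρ → ρ < ρ₁ → ∀ᶠ n : ℕ in Filter.atTop,
        ∀ Ψ : PeriodicTrialState (n + 1) (sideLength ρ (n + 1)), ContDiff ℝ 3 Ψ.ψ →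
          periodicEnergy v Ψ = periodicGroundStateEnergy v (n + 1) (sideLength ρ (n + 1)) →
          periodicEnergy v Ψ ≠ ⊤ → (∀ X, Ψ.ψ X = (‖Ψ.ψ X‖ : ℂ)) → (∀ X, Ψ.ψ X ≠ 0) →
          (∫⁻ X in cellN (n + 1) (sideLength ρ (n + 1)),
              periodicInteraction (Set.indicator (Set.Iic R₀) (fun _ : ℝ => (1 : ℝ≥0∞)))
                (sideLength ρ (n + 1)) X * (‖Ψ.ψ X‖₊ : ℝ≥0∞) ^ 2)
            ≤ ENNReal.ofReal (C_N * ρ * ((n : ℝ) + 1))) →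
      ∃ C_P : ℝ, 0 ≤ C_P ∧ ∃ ρ₁ : ℝ, 0 < ρ₁ ∧ ∀ ρ : ℝ, 0 < ρ → ρ < ρ₁ → ∀ᶠ n : ℕ in Filter.atTop,
        ∀ Ψ : PeriodicTrialState (n + 1) (sideLength ρ (n + 1)), ContDiff ℝ 3 Ψ.ψ →
          periodicEnergy v Ψ = periodicGroundStateEnergy v (n + 1) (sideLength ρ (n + 1)) →
          periodicEnergy v Ψ ≠ ⊤ → (∀ X, Ψ.ψ X = (‖Ψ.ψ X‖ : ℂ)) → (∀ X, Ψ.ψ X ≠ 0) →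
          (∫⁻ X in cellN (n + 1) (sideLength ρ (n + 1)),
              periodicInteraction (fun r : ℝ => ENNReal.ofReal (r ^ 2 *
                ‖iteratedFDeriv ℝ 2 (fun x : Space => (v ‖x‖).toReal)
                  (r • EuclideanSpace.single (0 : Fin 3) (1 : ℝ))‖)) (sideLength ρ (n + 1)) X *
                (‖Ψ.ψ X‖₊ : ℝ≥0∞) ^ 2)
            ≤ ENNReal.ofReal (C_P * ρ * ((n : ℝ) + 1)) :=
  Summit.AtomisticToContinuum.BoseEinsteinCondensation.Theorems.stub_pairMomentOfPairCount

/-! ## v6 stubs for the coreless residual (REGISTERED; statements in tree vocabulary only) -/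

/-- **S7out `stub_pairCountDomination`** (outer count; Lee's cell/torus machinery for a CORED comparison potential).
For every measurable `v ≥ 0` and radii `0 < r_in`, `0 < R₀` there are `K ≥ 0`, `L₀ > 0` such that for every particle
number, every torus side `L ≥ L₀` and EVERY periodic trial state
`E_Ψ #{i<j : |xᵢ−xⱼ|_T ≤ R₀} ≤ K · (periodicEnergy v Ψ + E_Ψ #{i<j : |xᵢ−xⱼ|_T ≤ r_in})` (pairs counted through the
periodised indicators). Proof: put `v' = v + 1_{(-∞,r_in]}` (core `≥ 1` on `[0,r_in)`) and `W = 1_{(-∞,R₀]}` (range `R₀`);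
classical stability `t₁ ∑_{i<j} W ≤ ∑_{i<j} v' + N` with `t₁ = 1/max(K₁,1)` is `PairCubeCounting.pair_count_le r_in R₀`
(`interaction_ofReal` for the bookkeeping); the two-body floor `exists_le_neumannGroundStateEnergy_two` (w = 1,
r₁ = r_in, ℓ₁ = max (4R₀) (r_in/2)), `cube_domination`, `setLIntegral_sameCell_le_boxN`, the mesh
`NoBindingOfStability.exists_mesh` (L₀ = 2ℓ₁) and `torus_domination_of_grid` give
`c ∫(∑W^per)|Ψ|² ≤ 8 periodicEnergy v' Ψ`, and `periodicEnergy v' Ψ = periodicEnergy v Ψ + ∫(∑ 1^per_{≤r_in})|Ψ|²`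
(`PuffFloorPairMomentOfPairCount.periodicInteraction_add`, `lintegral_add_left`). Template:
`Theorems/BECConjugateDominationPuffFloorNoBindingOfStability.lean`. Size M. [Lee2009 Thm 7, Lemmas 9, 11; LSSY2005 (2.52)–(2.53)] -/
theorem stub_pairCountDomination :
    ∀ v : ℝ → ℝ≥0∞, Measurable v → ∀ rin R₀ : ℝ, 0 < rin → 0 < R₀ →
      ∃ K L₀ : ℝ, 0 ≤ K ∧ 0 < L₀ ∧ ∀ (N : ℕ) (L : ℝ), L₀ ≤ L → ∀ Ψ : PeriodicTrialState N L,
        (∫⁻ X in cellN N L,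
            periodicInteraction (Set.indicator (Set.Iic R₀) (fun _ : ℝ => (1 : ℝ≥0∞))) L X *
              (‖Ψ.ψ X‖₊ : ℝ≥0∞) ^ 2)
          ≤ ENNReal.ofReal K * (periodicEnergy v Ψ +
              ∫⁻ X in cellN N L,
                periodicInteraction (Set.indicator (Set.Iic rin) (fun _ : ℝ => (1 : ℝ≥0∞))) L X *
                  (‖Ψ.ψ X‖₊ : ℝ≥0∞) ^ 2) := by
  sorry

/-- **S7a `stub_weakPairSubsolution`** (the pair density of the minimiser is a WEAK subsolution; lead's stub).
For a smooth finite-range `v` (range `R₀`, `2R₀ < L`) and a real `C³` exact minimiser `Ψ` of `n+2` bosons on the torus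
of side `L`, every non-negative `Lℤ³`-periodic `C²` test function `f` of the pair variable satisfies
`∫_{Λ^{n+2}} [(Δf)(x₀−x₁) + (E₀(n+2,L) − E₀(n,L)) f(x₀−x₁)] |Ψ|² ≥ 0`.
Proof: the strong Euler–Lagrange equation `ΔΨ = (V^per − E₀)Ψ` (`Theorems.stub_eulerLagrange`) times `F Ψ`,
`F(X) = f(x₀−x₁)`, integrated over the cell and integrated by parts twice on the torus
(`PeriodicConfigLaplacian`, `PeriodicTorusByParts`): `½∫(Δ_X F)Ψ² = ∫F|∇Ψ|² + ∫F(V^per − E₀(n+2))Ψ²` with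
`Δ_X F = 2(Δf)(x₀−x₁)`; on the right drop `|∇₀Ψ|², |∇₁Ψ|²`, the cross repulsions and `v^per(x₀−x₁)FΨ² ≥ 0`, and bound
the slice form `∫F[∑_{j≥2}|∇ⱼΨ|² + ∑_{2≤i<j}v^per Ψ²] ≥ E₀(n)∫FΨ²` fibrewise in `(x₀,x₁)`
(`periodicGroundStateEnergy_mul_lintegral_le` on the `C¹` periodic symmetric slice, Fubini via `piFinSuccAbove`).
Size L. [LSSY2005 Lemma C.2 (two-body precedent); folklore (local energy identities)] -/
theorem stub_weakPairSubsolution :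
    ∀ v : ℝ → ℝ≥0∞, IsRepulsiveFiniteRange v → (∀ r, v r ≠ ⊤) →
      ContDiff ℝ 2 (fun x : Space => (v ‖x‖).toReal) →
      ∀ R₀ : ℝ, 0 < R₀ → (∀ r, R₀ < r → v r = 0) →
      ∀ (n : ℕ) (L : ℝ), 0 < L → 2 * R₀ < L → ∀ Ψ : PeriodicTrialState (n + 2) L,
        periodicEnergy v Ψ = periodicGroundStateEnergy v (n + 2) L → periodicEnergy v Ψ ≠ ⊤ →
        ContDiff ℝ 3 Ψ.ψ → (∀ X, Ψ.ψ X = (‖Ψ.ψ X‖ : ℂ)) →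
        ∀ f : Space → ℝ, ContDiff ℝ 2 f → (∀ z, 0 ≤ f z) →
          (∀ (z : Space) (q : Fin 3 → ℤ), f (z + latticeVec L q) = f z) →
          0 ≤ ∫ X in cellN (n + 2) L,
              ((Δ f) (X 0 - X 1) +
                ((periodicGroundStateEnergy v (n + 2) L).toReal -
                  (periodicGroundStateEnergy v n L).toReal) * f (X 0 - X 1)) * ‖Ψ.ψ X‖ ^ 2 := by
  sorry

/-- **S7b `stub_removalEnergy`** (two-particle removal energy is `O(ρ)`): for every measurable `v ≥ 0`, every `n` and
`L > 0`, `E₀(n+2, L) ≤ E₀(n, L) + (2n+1) L⁻³ ∫_{ℝ³} v(|x|)dx` (in `ℝ≥0∞`). Proof: for any periodic `n`-state `χ` the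
product `f(X) = L⁻³ χ(x₂,…,x_{n+1})` (two constant factors in the slots `0, 1`) is `C¹`, periodic and normalised on the
cell, so `E₀(n+2) ≤ ∫(|∇f|² + ∑v^per|f|²)` by `periodicGroundStateEnergy_le_lintegral_of_periodic` (bosonic = absolute
ground-state energy, NO symmetrisation needed); its kinetic energy is that of `χ`, the `2n+1` pairs meeting a constant
slot cost `L⁻³∫ṽ` each (`lintegral_cell_periodizedPotential_sub`, Fubini via `piFinSuccAbove`), the pairs inside `χ`
give its interaction; then `iInf` over `χ` (`ENNReal.iInf_add`). Size M. [LSSY2005 Thm 2.2 proof (constant trial factors)] -/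
theorem stub_removalEnergy :
    ∀ v : ℝ → ℝ≥0∞, Measurable v → ∀ (n : ℕ) (L : ℝ), 0 < L →
      periodicGroundStateEnergy v (n + 2) L ≤ periodicGroundStateEnergy v n L +
        ENNReal.ofReal ((2 * (n : ℝ) + 1) / L ^ 3) * ∫⁻ x : Space, v ‖x‖ := by
  sorry

/-- **S7c `stub_smearedPairDensityLaplacian`** (differentiation under the integral sign, twice). For a periodic trial
state `Ψ` of `n+2` particles and a `C²` kernel `k : ℝ³ → ℝ` with `k, Dk, D²k` bounded by `B`, the smeared pair density
`G_k(y) = ∫_{Λ^{n+2}} k(x₀ − x₁ − y)|Ψ(X)|² dX` is `C²` on `ℝ³` and its Laplacian is obtained by differentiating the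
kernel: `ΔG_k(y) = ∫ (Δk)(x₀ − x₁ − y)|Ψ|²` (`Ψ` is continuous and periodic, hence bounded on the bounded cell;
`hasFDerivAt_integral_of_dominated_of_fderiv_le` twice, continuity of the second derivative by dominated
convergence; `InnerProductSpace.laplacian_eq_iteratedFDeriv_orthonormalBasis`). Size M. [folklore] -/
theorem stub_smearedPairDensityLaplacian :
    ∀ (n : ℕ) (L : ℝ), 0 < L → ∀ (Ψ : PeriodicTrialState (n + 2) L) (k : Space → ℝ) (B : ℝ),
      ContDiff ℝ 2 k → (∀ z, |k z| ≤ B) → (∀ z, ‖fderiv ℝ k z‖ ≤ B) →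
      (∀ z, ‖iteratedFDeriv ℝ 2 k z‖ ≤ B) →
      ContDiff ℝ 2 (fun y : Space => ∫ X in cellN (n + 2) L, k (X 0 - X 1 - y) * ‖Ψ.ψ X‖ ^ 2) ∧
      ∀ y : Space,
        (Δ (fun y' : Space => ∫ X in cellN (n + 2) L, k (X 0 - X 1 - y') * ‖Ψ.ψ X‖ ^ 2)) y =
          ∫ X in cellN (n + 2) L, (Δ k) (X 0 - X 1 - y) * ‖Ψ.ψ X‖ ^ 2 := by
  sorry

/-- **S7d `stub_maxPrinciple`** (generalised interior maximum principle on a ball of `ℝ³`, absolute constant). There is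
`C_mp > 0` such that: if `u ∈ C²(ℝ³)`, `0 ≤ λ`, `λR² ≤ 1`, `Δu + λu ≥ 0` on the open ball `B(x₀,R)` and `u ≤ B` on the
sphere `|x − x₀| = R` with `B ≥ 0`, then `u ≤ C_mp·B` on the closed ball. Proof: `w(y) = ∏ₐ cos(κ(yₐ − x₀ₐ))`,
`κ = 3/(5R)`: on the closed ball `|yₐ − x₀ₐ| ≤ R`, so `w ≥ cos(3/5)³ ≥ (1 − 9/50)³ > 0`
(`Real.one_sub_sq_div_two_le_cos`), `w ≤ 1`, and `Δw = −3κ²w` with `3κ² = 27/(25R²) > λ`; `z = u/w` attains its max on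
the compact closed ball at `y*`; if `y*` is interior then along each axis `t ↦ z(y* + t eₐ)` has a local max at `0`,
so `∂ₐz(y*) = 0` and `∂ₐ²z(y*) ≤ 0` (one-variable second-derivative test), whence
`0 ≤ Δu + λu = wΔz + (λ − 3κ²) z w` at `y*` forces `z(y*) ≤ 0`; in all cases `max z ≤ B / min w`, i.e.
`u ≤ B/cos(3/5)³`. Size M. [ProtterWeinberger1967 Ch. 2 Thm 10; GilbargTrudinger2001 Cor. 3.2] -/
theorem stub_maxPrinciple :
    ∃ Cmp : ℝ, 0 < Cmp ∧ ∀ (u : Space → ℝ) (x₀ : Space) (R lam B : ℝ),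
      0 < R → 0 ≤ lam → lam * R ^ 2 ≤ 1 → 0 ≤ B → ContDiff ℝ 2 u →
      (∀ x ∈ Metric.ball x₀ R, 0 ≤ (Δ u) x + lam * u x) →
      (∀ x ∈ Metric.sphere x₀ R, u x ≤ B) →
      ∀ x ∈ Metric.closedBall x₀ R, u x ≤ Cmp * B := by
  sorry

/-- **S7in `stub_innerPairCount`** (lead's glue over S7a, S7c, S7d: no clustering INSIDE the barrier). For a smooth
finite coreless `v` (`v 0 = 0`) that does not vanish identically on `(0,∞)` there are `r_in > 0`, `C_in ≥ 0`, `L₁ > 0`,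
`λ₁ > 0` such that on every torus of side `L ≥ L₁`, every real `C³` exact minimiser `Ψ` of `n+2` bosons with
removal energy `E₀(n+2,L) − E₀(n,L) ≤ λ₁` has `E_Ψ #{i<j : |xᵢ−xⱼ|_T ≤ r_in} ≤ C_in · periodicEnergy v Ψ`.
Proof: `r_*` = an argmax of `r ↦ v r` on `[0,R₀]` (`> 0`, value `v_max > 0`), `δ₀ ≤ r_*/2` with `v ≥ v_max/2` on
`[r_*−δ₀, r_*+δ₀]`, `r_in = r_*/2`, `λ₁ = 1/r_*²`, `L₁ = 4R₀ + 4r_*`; `k` = periodisation of a flat-top bump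
(`= 1` on `B(0,δ₀/2)`, supported in `B(0,δ₀)`, values in `[0,1]`); `G_k(y) = E_Ψ[k(x₀−x₁−y)]` is `C²` with
`ΔG_k + λ₁G_k ≥ 0` (S7c + S7a with `f = k(· − y)`); on the sphere `|y| = r_*`, `k(z−y) ≤ (2/v_max)v^per(z)` pointwise,
so `G_k(y) ≤ (2/v_max) E_Ψ[v^per(x₀−x₁)]`; S7d on `B(0,r_*)`; a finite `δ₀/2`-net `{y_m}` of `B̄(0,r_*/2)` gives
`1^per_{≤r_in}(z) ≤ ∑_m k(z − y_m)`; Bose symmetry `E_Ψ ∑_{i<j} = C(N,2) E_Ψ[(0,1) term]` on both sides, and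
`C(N,2) E_Ψ[v^per(x₀−x₁)] ≤ periodicEnergy v Ψ`. Size L. [folklore; ProtterWeinberger1967 Ch. 2] -/
theorem stub_innerPairCount :
    ∀ v : ℝ → ℝ≥0∞, IsRepulsiveFiniteRange v → (∀ r, v r ≠ ⊤) →
      ContDiff ℝ 2 (fun x : Space => (v ‖x‖).toReal) →
      v 0 = 0 → (∃ r, 0 < r ∧ 0 < v r) →
      ∃ rin Cin L₁ lam₁ : ℝ, 0 < rin ∧ 0 ≤ Cin ∧ 0 < L₁ ∧ 0 < lam₁ ∧
        ∀ (n : ℕ) (L : ℝ), L₁ ≤ L → ∀ Ψ : PeriodicTrialState (n + 2) L,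
          periodicEnergy v Ψ = periodicGroundStateEnergy v (n + 2) L → periodicEnergy v Ψ ≠ ⊤ →
          ContDiff ℝ 3 Ψ.ψ → (∀ X, Ψ.ψ X = (‖Ψ.ψ X‖ : ℂ)) →
          (periodicGroundStateEnergy v (n + 2) L).toReal - (periodicGroundStateEnergy v n L).toReal ≤ lam₁ →
          (∫⁻ X in cellN (n + 2) L,
              periodicInteraction (Set.indicator (Set.Iic rin) (fun _ : ℝ => (1 : ℝ≥0∞))) L X *
                (‖Ψ.ψ X‖₊ : ℝ≥0∞) ^ 2)
            ≤ ENNReal.ofReal Cin * periodicEnergy v Ψ := by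
  sorry

/-! ## Composition (kernel-checked; no `sorry` below this line) -/

/-- `L_{n+1}(ρ) > 0`. [folklore] -/
theorem sideLength_succ_pos' {ρ : ℝ} (hρ : 0 < ρ) (n : ℕ) : 0 < sideLength ρ (n + 1) := by
  unfold sideLength
  apply Real.rpow_pos_of_pos
  positivity

/-- **S7′ `corelessPairCount` (THEOREM modulo S7out, S7in, S7b; c1's reshaped residual = the planner's
`PairCountBound`).** For a smooth-class coreless `v` (`v 0 = 0`, not identically zero on `(0,∞)`) with range
parameter `R₀`, the expected number of pairs at torus distance `≤ R₀` in the positive `C³` exact minimiser is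
`≤ C_N ρ (n+1)`, eventually in `n`, for `ρ < ρ₁`. Composition: `L = L_{n+1}(ρ) → ∞` passes `L₀` (S7out) and `L₁`
(S7in); S7b with `L³ = (n+1)/ρ` gives `E₀(n+1) − E₀(n−1) ≤ 2ρ‖ṽ‖₁ ≤ λ₁` for `ρ < ρ₁ = λ₁/(2‖ṽ‖₁+1)`;
count(R₀) ≤ K(E₀ + C_in E₀) and Born `E₀ ≤ ‖ṽ‖₁ρ(n+1)` (`bornEnergyBound`). -/
theorem corelessPairCount :
    ∀ v : ℝ → ℝ≥0∞, IsRepulsiveFiniteRange v → (∀ r, v r ≠ ⊤) →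
      ContDiff ℝ 2 (fun x : Space => (v ‖x‖).toReal) →
      (∃ Cₑ : ℝ, ∀ x : Space, ‖iteratedFDeriv ℝ 2 (fun x : Space => (v ‖x‖).toReal) x‖
          ≤ Cₑ * Real.sqrt ((v ‖x‖).toReal)) →
      v 0 = 0 → (∃ r, 0 < r ∧ 0 < v r) → ∀ R₀ : ℝ, 0 < R₀ → (∀ r, R₀ < r → v r = 0) →
      ∃ C_N : ℝ, 0 ≤ C_N ∧ ∃ ρ₁ : ℝ, 0 < ρ₁ ∧ ∀ ρ : ℝ, 0 < ρ → ρ < ρ₁ → ∀ᶠ n : ℕ in atTop,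
        ∀ Ψ : PeriodicTrialState (n + 1) (sideLength ρ (n + 1)), ContDiff ℝ 3 Ψ.ψ →
          periodicEnergy v Ψ = periodicGroundStateEnergy v (n + 1) (sideLength ρ (n + 1)) →
          periodicEnergy v Ψ ≠ ⊤ → (∀ X, Ψ.ψ X = (‖Ψ.ψ X‖ : ℂ)) → (∀ X, Ψ.ψ X ≠ 0) →
          (∫⁻ X in cellN (n + 1) (sideLength ρ (n + 1)),
              periodicInteraction (Set.indicator (Set.Iic R₀) (fun _ : ℝ => (1 : ℝ≥0∞)))
                (sideLength ρ (n + 1)) X * (‖Ψ.ψ X‖₊ : ℝ≥0∞) ^ 2)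
            ≤ ENNReal.ofReal (C_N * ρ * ((n : ℝ) + 1)) := by
  intro v hv hfin hC2 _hedge h0 hpos R₀ hR₀ _hrange
  obtain ⟨rin, Cin, L₁, lam₁, hrin, hCin, hL₁, hlam₁, hin⟩ := stub_innerPairCount v hv hfin hC2 h0 hpos
  obtain ⟨K, L₀, hK, hL₀, hout⟩ := stub_pairCountDomination v hv.1 rin R₀ hrin hR₀
  obtain ⟨CE, hCE0, hCE⟩ := bornEnergyBound v hv hfin hC2
  have hItop : (∫⁻ x : Space, v ‖x‖) ≠ ⊤ := (lintegral_lt_top_of_smooth hv hfin hC2).ne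
  set V₁ : ℝ := (∫⁻ x : Space, v ‖x‖).toReal with hV₁
  have hV₁0 : 0 ≤ V₁ := ENNReal.toReal_nonneg
  refine ⟨K * (CE + Cin * CE), by positivity, lam₁ / (2 * V₁ + 1), by positivity, fun ρ hρ hρ₁ => ?_⟩
  have hρlam : 2 * ρ * V₁ ≤ lam₁ := by
    rw [lt_div_iff₀ (by positivity)] at hρ₁
    nlinarith
  -- the bound on a fixed torus of side `L ≥ max L₀ L₁` holding `n' + 2` particles, `n' ≥ 1`
  have key : ∀ (n' : ℕ) (L : ℝ), 1 ≤ n' → 0 < L → L₀ ≤ L → L₁ ≤ L →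
      ((n' : ℝ) + 2) / L ^ 3 = ρ →
      ∀ Ψ : PeriodicTrialState (n' + 2) L, ContDiff ℝ 3 Ψ.ψ →
        periodicEnergy v Ψ = periodicGroundStateEnergy v (n' + 2) L → periodicEnergy v Ψ ≠ ⊤ →
        (∀ X, Ψ.ψ X = (‖Ψ.ψ X‖ : ℂ)) →
        (∫⁻ X in cellN (n' + 2) L,
            periodicInteraction (Set.indicator (Set.Iic R₀) (fun _ : ℝ => (1 : ℝ≥0∞))) L X *
              (‖Ψ.ψ X‖₊ : ℝ≥0∞) ^ 2)
          ≤ ENNReal.ofReal K * (periodicEnergy v Ψ + ENNReal.ofReal Cin * periodicEnergy v Ψ) := by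
    intro n' L hn' hLpos hL₀L hL₁L hL3 Ψ hC3 hmin hfinE hreal
    obtain ⟨n'', hn''⟩ : ∃ n'', n' = n'' + 1 := ⟨n' - 1, by omega⟩
    have hL3pos : 0 < L ^ 3 := by positivity
    -- the removal energy is `≤ λ₁`
    have hE0fin : periodicGroundStateEnergy v n' L ≠ ⊤ := by
      rw [hn'']
      exact ne_top_of_le_ne_top ENNReal.ofReal_ne_top (hCE n'' L hLpos)
    have hrem : (periodicGroundStateEnergy v (n' + 2) L).toReal -
        (periodicGroundStateEnergy v n' L).toReal ≤ lam₁ := by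
      have h := stub_removalEnergy v hv.1 n' L hLpos
      have hc : 0 ≤ (2 * (n' : ℝ) + 1) / L ^ 3 := by positivity
      have h' : (periodicGroundStateEnergy v (n' + 2) L).toReal ≤
          (periodicGroundStateEnergy v n' L).toReal + (2 * (n' : ℝ) + 1) / L ^ 3 * V₁ := by
        have := ENNReal.toReal_mono (ENNReal.add_ne_top.2 ⟨hE0fin,
          ENNReal.mul_ne_top ENNReal.ofReal_ne_top hItop⟩) h
        rwa [ENNReal.toReal_add hE0fin (ENNReal.mul_ne_top ENNReal.ofReal_ne_top hItop),
          ENNReal.toReal_mul, ENNReal.toReal_ofReal hc] at this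
      have hcoef : (2 * (n' : ℝ) + 1) / L ^ 3 ≤ 2 * ρ := by
        rw [← hL3, div_le_iff₀ hL3pos, mul_div_assoc', div_mul_cancel₀ _ hL3pos.ne']
        linarith
      have : (2 * (n' : ℝ) + 1) / L ^ 3 * V₁ ≤ 2 * ρ * V₁ := mul_le_mul_of_nonneg_right hcoef hV₁0
      linarith
    -- inner and outer counts
    have hinner := hin n' L hL₁L Ψ hmin hfinE hC3 hreal hrem
    calc _ ≤ ENNReal.ofReal K * (periodicEnergy v Ψ +
            ∫⁻ X in cellN (n' + 2) L,
              periodicInteraction (Set.indicator (Set.Iic rin) (fun _ : ℝ => (1 : ℝ≥0∞))) L X *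
                (‖Ψ.ψ X‖₊ : ℝ≥0∞) ^ 2) := hout (n' + 2) L hL₀L Ψ
      _ ≤ ENNReal.ofReal K * (periodicEnergy v Ψ + ENNReal.ofReal Cin * periodicEnergy v Ψ) := by
          gcongr
  filter_upwards [(tendsto_sideLength_succ hρ).eventually_ge_atTop (max L₀ L₁), eventually_ge_atTop 2]
    with n hnL hn2 Ψ hC3 hmin hfinE hreal hne
  obtain ⟨n', rfl⟩ : ∃ n', n = n' + 1 := ⟨n - 1, by omega⟩
  have hLpos : 0 < sideLength ρ (n' + 1 + 1) := sideLength_succ_pos' hρ _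
  have hL3 : ((n' : ℝ) + 2) / sideLength ρ (n' + 1 + 1) ^ 3 = ρ := by
    have h := div_sideLength_pow_three hρ (Nat.succ_pos (n' + 1))
    push_cast at h
    rw [show ((n' : ℝ) + 2) = (n' : ℝ) + 1 + 1 by ring]
    exact h
  have hkey := key n' (sideLength ρ (n' + 1 + 1)) (by omega) hLpos (le_trans (le_max_left _ _) hnL)
    (le_trans (le_max_right _ _) hnL) hL3 Ψ hC3 hmin hfinE hreal
  -- the energy of the minimiser
  have hE : periodicEnergy v Ψ ≤ ENNReal.ofReal (CE * ρ * (((n' + 1 : ℕ) : ℝ) + 1)) := by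
    rw [hmin, ← const_mul_sq_div_sideLength_cube hρ CE (n' + 1)]
    exact hCE (n' + 1) _ hLpos
  set X : ℝ := CE * ρ * (((n' + 1 : ℕ) : ℝ) + 1) with hX
  have hX0 : 0 ≤ X := by positivity
  calc _ ≤ ENNReal.ofReal K * (periodicEnergy v Ψ + ENNReal.ofReal Cin * periodicEnergy v Ψ) := hkey
    _ ≤ ENNReal.ofReal K * (ENNReal.ofReal X + ENNReal.ofReal Cin * ENNReal.ofReal X) := by gcongr
    _ = ENNReal.ofReal (K * (CE + Cin * CE) * ρ * (((n' + 1 : ℕ) : ℝ) + 1)) := by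
        rw [← ENNReal.ofReal_mul hCin, ← ENNReal.ofReal_add hX0 (by positivity), ← ENNReal.ofReal_mul hK]
        congr 1
        rw [hX]
        ring

/-- If `v` vanishes at every `r ≥ 0` then `ṽ(x) = v(|x|)` is the zero function, so the Puff weight profile
`W(r) = r²‖D²ṽ(r e₀)‖` vanishes identically. [folklore] -/
theorem puffWeight_eq_zero_of_forall (v : ℝ → ℝ≥0∞) (h : ∀ r, 0 ≤ r → v r = 0) (r : ℝ) :
    ENNReal.ofReal (r ^ 2 * ‖iteratedFDeriv ℝ 2 (fun x : Space => (v ‖x‖).toReal)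
      (r • EuclideanSpace.single (0 : Fin 3) (1 : ℝ))‖) = 0 := by
  have hzero : (fun x : Space => (v ‖x‖).toReal) = fun _ => (0 : ℝ) := by
    funext x
    rw [h _ (norm_nonneg x), ENNReal.toReal_zero]
  rw [hzero, iteratedFDeriv_fun_zero]
  simp

/-- **S7 `corelessPairMoment` (THEOREM modulo S7′).** For a smooth-class coreless `v` the Puff pair functional of the
positive `C³` minimiser is `O(ρN)`: if `v` vanishes on `[0,∞)` the weight is identically zero; otherwise S7′ feeds c1's
landed reduction `stub_pairMomentOfPairCount`. -/
theorem corelessPairMoment :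
    ∀ v : ℝ → ℝ≥0∞, IsRepulsiveFiniteRange v → (∀ r, v r ≠ ⊤) →
      ContDiff ℝ 2 (fun x : Space => (v ‖x‖).toReal) →
      (∃ Cₑ : ℝ, ∀ x : Space, ‖iteratedFDeriv ℝ 2 (fun x : Space => (v ‖x‖).toReal) x‖
          ≤ Cₑ * Real.sqrt ((v ‖x‖).toReal)) →
      v 0 = 0 →
      ∃ C_P : ℝ, 0 ≤ C_P ∧ ∃ ρ₁ : ℝ, 0 < ρ₁ ∧ ∀ ρ : ℝ, 0 < ρ → ρ < ρ₁ → ∀ᶠ n : ℕ in atTop,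
        ∀ Ψ : PeriodicTrialState (n + 1) (sideLength ρ (n + 1)), ContDiff ℝ 3 Ψ.ψ →
          periodicEnergy v Ψ = periodicGroundStateEnergy v (n + 1) (sideLength ρ (n + 1)) →
          periodicEnergy v Ψ ≠ ⊤ → (∀ X, Ψ.ψ X = (‖Ψ.ψ X‖ : ℂ)) → (∀ X, Ψ.ψ X ≠ 0) →
          (∫⁻ X in cellN (n + 1) (sideLength ρ (n + 1)),
              periodicInteraction (fun r : ℝ => ENNReal.ofReal (r ^ 2 *
                ‖iteratedFDeriv ℝ 2 (fun x : Space => (v ‖x‖).toReal)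
                  (r • EuclideanSpace.single (0 : Fin 3) (1 : ℝ))‖)) (sideLength ρ (n + 1)) X *
                (‖Ψ.ψ X‖₊ : ℝ≥0∞) ^ 2)
            ≤ ENNReal.ofReal (C_P * ρ * ((n : ℝ) + 1)) := by
  intro v hv hfin hC2 hedge h0
  by_cases hpos : ∃ r, 0 < r ∧ 0 < v r
  · obtain ⟨R₀, hR₀, hrange⟩ := exists_pos_range hv
    exact stub_pairMomentOfPairCount v hv hfin hC2 hedge R₀ hrange
      (corelessPairCount v hv hfin hC2 hedge h0 hpos R₀ hR₀ hrange)
  · -- `v` vanishes on `[0, ∞)`: the weight is zero and so is the pair functional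
    have hzero : ∀ r, 0 ≤ r → v r = 0 := by
      intro r hr
      rcases hr.eq_or_lt with rfl | hr'
      · exact h0
      · by_contra hne
        exact hpos ⟨r, hr', pos_iff_ne_zero.2 hne⟩
    refine ⟨0, le_rfl, 1, one_pos, fun ρ hρ hρ₁ => Filter.Eventually.of_forall fun n Ψ _ _ _ _ _ => ?_⟩
    have hW : ∀ X : Config (n + 1),
        periodicInteraction (fun r : ℝ => ENNReal.ofReal (r ^ 2 *
          ‖iteratedFDeriv ℝ 2 (fun x : Space => (v ‖x‖).toReal)
            (r • EuclideanSpace.single (0 : Fin 3) (1 : ℝ))‖)) (sideLength ρ (n + 1)) X = 0 := by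
      intro X
      unfold periodicInteraction periodizedPotential
      refine Finset.sum_eq_zero fun i _ => Finset.sum_eq_zero fun j _ => ?_
      exact ENNReal.tsum_eq_zero.2 fun q =>
        puffWeight_eq_zero_of_forall v hzero _
    simp [hW]

/-- **The coreless branch assembled**: for `v 0 = 0`, S7 + S3 + S4a + S4b + S5 + S6 give the crux's conclusion
(lets inlined) with `C = c₁‖ṽ‖₁ + c₂C_P`. Kernel-checked glue (lead-0, unchanged). -/
theorem puffFloorCoreless_of_pairMoment
    (v : ℝ → ℝ≥0∞) (hv : IsRepulsiveFiniteRange v) (hfin : ∀ r, v r ≠ ⊤)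
    (hC2 : ContDiff ℝ 2 (fun x : Space => (v ‖x‖).toReal))
    (hedge : ∃ Cₑ : ℝ, ∀ x : Space, ‖iteratedFDeriv ℝ 2 (fun x : Space => (v ‖x‖).toReal) x‖
        ≤ Cₑ * Real.sqrt ((v ‖x‖).toReal))
    (h0 : v 0 = 0) :
    ∃ C : ℝ, 0 ≤ C ∧ ∃ ρ₀ : ℝ, 0 < ρ₀ ∧ ∀ ρ : ℝ, 0 < ρ → ρ < ρ₀ → ∀ᶠ n : ℕ in Filter.atTop,
        ∀ Ψ : PeriodicTrialState (n + 1) (sideLength ρ (n + 1)),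
          periodicEnergy v Ψ = periodicGroundStateEnergy v (n + 1) (sideLength ρ (n + 1)) →
          periodicEnergy v Ψ ≠ ⊤ → (∀ X, Ψ.ψ X = (‖Ψ.ψ X‖ : ℂ)) → (∀ X, Ψ.ψ X ≠ 0) →
          ∀ m : Fin 3 → ℤ, m ≠ 0 →
            ‖(2 * Real.pi / sideLength ρ (n + 1)) • latticeVec 1 m‖ /
                Real.sqrt (‖(2 * Real.pi / sideLength ρ (n + 1)) • latticeVec 1 m‖ ^ 2 + C * ρ) ≤
              ((n : ℝ) + 1)⁻¹ *
                ∫ X in cellN (n + 1) (sideLength ρ (n + 1)),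
                  ‖∑ j : Fin (n + 1), cellWave (sideLength ρ (n + 1)) m (X j)‖ ^ 2 * ‖Ψ.ψ X‖ ^ 2 := by
  obtain ⟨R₀, hR₀, hrange⟩ := exists_pos_range hv
  obtain ⟨CE, hCE0, hCE⟩ := bornEnergyBound v hv hfin hC2
  obtain ⟨c₁, c₂, hc₁, hc₂, hPuff⟩ := stub_puffFeynmanFloor
  obtain ⟨CP, hCP0, ρ₁, hρ₁, hP⟩ := corelessPairMoment v hv hfin hC2 hedge h0
  refine ⟨c₁ * CE + c₂ * CP, by positivity, ρ₁, hρ₁, fun ρ hρ hρ₁' => ?_⟩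
  filter_upwards [hP ρ hρ hρ₁',
    (tendsto_sideLength_succ hρ).eventually_gt_atTop (2 * R₀)] with n hn h2R₀ Ψ hmin hfinE hreal hne m hm
  have hLpos : 0 < sideLength ρ (n + 1) := sideLength_succ_pos' hρ n
  obtain ⟨Ψ₀, hmin₀, _hfin₀, hC3₀, hreal₀, hne₀⟩ :=
    Theorems.stub_positiveMinimiser v hv hfin hC2 hedge n (sideLength ρ (n + 1)) hLpos
  have hΨ : Ψ = Ψ₀ :=
    Theorems.stub_positiveMinimiserUnique v hv.1 n (sideLength ρ (n + 1)) hLpos Ψ Ψ₀ hmin hfinE hreal hne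
      hmin₀ hreal₀ hne₀
  have hC3 : ContDiff ℝ 3 Ψ.ψ := by rw [hΨ]; exact hC3₀
  have hEL := Theorems.stub_eulerLagrange v hv hfin hC2 R₀ hR₀ hrange n (sideLength ρ (n + 1)) hLpos h2R₀ Ψ
    hC3 hmin hfinE
  have hPint := hn Ψ hC3 hmin hfinE hreal hne
  have hE : periodicEnergy v Ψ ≤ ENNReal.ofReal (CE * ρ * ((n : ℝ) + 1)) := by
    rw [hmin, ← const_mul_sq_div_sideLength_cube hρ CE n]
    exact hCE n (sideLength ρ (n + 1)) hLpos
  have hT : (∫⁻ X in cellN (n + 1) (sideLength ρ (n + 1)), kineticDensity Ψ.ψ X)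
      ≤ ENNReal.ofReal (CE * ρ * ((n : ℝ) + 1)) :=
    le_trans (lintegral_mono fun X => le_self_add) hE
  have key := weighted_add_le (by positivity) (by positivity) hc₁ hc₂ hT hPint
  have hring : c₁ * (CE * ρ * ((n : ℝ) + 1)) + c₂ * (CP * ρ * ((n : ℝ) + 1)) =
      (c₁ * CE + c₂ * CP) * ρ * ((n : ℝ) + 1) := by ring
  rw [hring] at key
  exact hPuff v hv hfin hC2 R₀ hR₀ hrange n (sideLength ρ (n + 1)) hLpos h2R₀ Ψ hC3 hmin hfinE hreal hne
    hEL ((c₁ * CE + c₂ * CP) * ρ) (by positivity) key m hm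

/-- **`PuffFloor` from the line `coupling-slope-pocket`** (kernel-checked, no `sorry` of its own): case split on
the core. Solid core `0 < v 0`: S8 (landed). Coreless `v 0 = 0`: `puffFloorCoreless_of_pairMoment`. The crux's `let`s
are definitionally the inlined forms. -/
theorem PuffFloor_of : PuffFloor := by
  intro v hv hfin hC2 hedge
  by_cases hcore : 0 < v 0
  · exact stub_puffFloorSolidCore v hv hfin hC2 hedge hcore
  · have h0 : v 0 = 0 := le_antisymm (not_lt.1 hcore) bot_le
    exact puffFloorCoreless_of_pairMoment v hv hfin hC2 hedge h0

end Summit.AtomisticToContinuum.BoseEinsteinCondensation.Cruxes.PuffFloor.CouplingSlopePocket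

end
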